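import Mathlib
import Summits.KontsevichZagierPeriods.KontsevichZagierPeriods.Theorems.SoloInformedRungTwoFinal
import Summits.KontsevichZagierPeriods.KontsevichZagierPeriods.Theorems.SoloInformedArcPieces
import Summits.KontsevichZagierPeriods.KontsevichZagierPeriods.Theorems.SoloInformedKappaKills
import HarnessLib

/-!
# SoloInformed — the curve sector of the Kontsevich–Zagier calculus is decided by Huber–Wüstholz

Solo programme `solo-KontsevichZagierPeriods-informed`, residency paper §6novies (Theorem XV).

The Rung-2 theorem `soloInformed_volumeRung_two` (areas of compact planar `ℚ`-semialgebraic
regions) was assembled from two ingredients: (i) every planar volume representation decomposes,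
modulo the four moves, in `V = P × P` (`P = FormalRep ⧸ relations` the naive formal period ring)
as a signed sum of the realisations `κ̃(σ) = (⟦[[0,1], Re(ω(γ)γ′)]⟧, ⟦[[0,1], Im(ω(γ)γ′)]⟧)` of
Huber–Wüstholz curve symbols `σ = (Z, ω, γ)` with Nash paths; (ii) the functional `κ` kills every
elementary relation (R1)–(R5) of the curve diagram (`SoloInformedKappaKills`, proved in the tree
through (APPROX), (HI), (HT)).  Ingredient (ii) and the final assembly never use the dimension.

This file isolates the dimension-free statement; it declares no new definitions (the **curve
sector** is the set `{x ∈ P | (x, 0) ∈ soloInformedKappaSpan}` of classes presented, by the four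
moves, as signed sums of realised curve periods; membership of `⟦[r]⟧` is
`soloInformedPer r ∈ soloInformedKappaSpan`).

* `soloInformed_kappaKills` — `SoloInformedKappaKills` holds (assembled from the landed
  `soloInformed_nashApprox`, `soloInformed_nashHI`, `soloInformed_kappaR4`, `soloInformed_kappaR5`).
* `soloInformed_eq_zero_of_mem_curveSector` — **THEOREM XV (kernel form).** Granted the
  Huber–Wüstholz theorem on linear relations of curve periods (`HuberWustholzCurvePeriods`, a named
  Literature fact), `evalP` has no kernel on the curve sector: `(x, 0) ∈ span`, `evalP x = 0 ⇒ x = 0`;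
  equivalently (`soloInformed_evalP_injOn_curveSector`) two classes of the sector with the same
  value are equal, and (`soloInformed_equivalent_of_mem_curveSector`) two integral representations
  OF ANY DIMENSIONS whose classes lie in the sector and whose values agree are KZ-equivalent.
* Members: compact planar volume representations (`soloInformed_per_mem_span_planar`, the
  content of `soloInformed_planarPieces`, no interior hypothesis), bounded non-negative continuous
  arcs `[(a,b), g]` with algebraic end points (`soloInformed_arc_mem_span`, landed), everything
  equivalent to a sum of members (`soloInformed_per_mem_span_of_sub_sum_mem_relations`).
* `soloInformed_volumeRung_on_class_of_mem_span` — **rung `d` holds on every class of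
  `d`-dimensional representations whose members lie in the curve sector** (any `d`); Rung 2
  (`soloInformed_volumeRung_two`) is the class "all compact planar regions".  The residency
  paper (§6novies, Theorem XVI) shows that in dimension 3 the class contains all compact solids
  bounded by planes and quadrics and, more generally, by real algebraic surfaces whose volume-flux
  class is supported on algebraic curves (weight ≤ 2), by one Stokes move per boundary patch with
  a rational primitive 1-form regular away from a non-real curve.

What the theorem says about the conjecture: the Kontsevich–Zagier period conjecture restricted to
the curve sector (the "1-motivic part" of the naive calculus, in every dimension) is a theorem
granted [HW22, Thm. 13.3]; the open content of volume rung 3 is confined to solids whose volume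
class has weight ≥ 3 or a non-algebraic `H²`-component (residency paper Thm. II: `π²` versus
`log 2 · log 3`).

References: A. Huber, G. Wüstholz, *Transcendence and linear relations of 1-periods*, CUP 2022,
Thm. 13.3, §7.2, §12; M. Kontsevich, D. Zagier, *Periods* (2001), §1.2.
-/

noncomputable section

open Set MeasureTheory
open Literature.NumberTheory.Transcendental Literature.NumberTheory.Transcendental.KZ
open Literature.NumberTheory.Transcendental.CurvePeriods Literature.ModelTheory.ExponentialFields

namespace Summit.KontsevichZagierPeriods.KontsevichZagierPeriods.Theorems

/-! ## 1. `κ` kills the elementary relations (assembled) -/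

/-- **`SoloInformedKappaKills` holds**: the functional `κ = κ̃ ∘ N` on Huber–Wüstholz symbols
vanishes on the elementary relations (R1)–(R5), by the landed (APPROX), (HI), (R4κ), (R5κ). -/
theorem soloInformed_kappaKills : SoloInformedKappaKills :=
  soloInformed_kappaKills_of soloInformed_nashApprox soloInformed_nashHI
    (soloInformed_kappaR4 soloInformed_nashApprox soloInformed_nashHI)
    (soloInformed_kappaR5 soloInformed_nashApprox soloInformed_nashHT)

/-! ## 2. The curve sector `{x | (x, 0) ∈ span}` is a subgroup of `P` -/

/-- `(x + y, 0) = (x, 0) + (y, 0)` in `V`. -/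
theorem soloInformedV_mk_zero_add (x y : FormalPeriodRing) :
    SoloInformedV.mk (x + y) 0 = SoloInformedV.mk x 0 + SoloInformedV.mk y 0 := by
  ext <;> simp [SoloInformedV.fst_mk, SoloInformedV.snd_mk]

/-- `(-x, 0) = -(x, 0)` in `V`. -/
theorem soloInformedV_mk_zero_neg (x : FormalPeriodRing) :
    SoloInformedV.mk (-x) 0 = -SoloInformedV.mk x 0 := by
  ext <;> simp [SoloInformedV.fst_mk, SoloInformedV.snd_mk]

/-- `(x - y, 0) = (x, 0) - (y, 0)` in `V`. -/
theorem soloInformedV_mk_zero_sub (x y : FormalPeriodRing) :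
    SoloInformedV.mk (x - y) 0 = SoloInformedV.mk x 0 - SoloInformedV.mk y 0 := by
  ext <;> simp [SoloInformedV.fst_mk, SoloInformedV.snd_mk]

/-- The curve sector is closed under differences. -/
theorem soloInformed_mk_sub_mem_span {x y : FormalPeriodRing}
    (hx : SoloInformedV.mk x 0 ∈ soloInformedKappaSpan)
    (hy : SoloInformedV.mk y 0 ∈ soloInformedKappaSpan) :
    SoloInformedV.mk (x - y) 0 ∈ soloInformedKappaSpan := by
  rw [soloInformedV_mk_zero_sub]
  exact sub_mem hx hy

/-- **Membership = a presentation by curve pieces**: `(x, 0)` lies in the span iff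
`(x, 0) = Σ εᵢ • κ̃(σᵢ)` for finitely many Nash curve symbols `σᵢ` and integers `εᵢ`. -/
theorem soloInformed_mk_mem_span_iff {x : FormalPeriodRing} :
    SoloInformedV.mk x 0 ∈ soloInformedKappaSpan ↔
      ∃ (k : ℕ) (σ : Fin k → PeriodSymbol) (ε : Fin k → ℤ)
        (hN : ∀ i, SoloInformedIsNashPath (σ i).γ.toFun),
        SoloInformedV.mk x 0 = ∑ i, ε i • soloInformedKappaTilde (σ i) (hN i) := by
  constructor
  · exact fun h => soloInformed_exists_sum_of_mem_span h
  · rintro ⟨k, σ, ε, hN, h⟩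
    rw [h]
    exact sum_mem fun i _ => AddSubgroup.zsmul_mem _ (soloInformed_kappaTilde_mem_span _ (hN i)) _

/-- For representations: `Per(r) = (⟦[r]⟧, 0)`. -/
theorem soloInformedPer_eq_mk {n : ℕ} (r : IntegralRep n) :
    soloInformedPer r = SoloInformedV.mk (toFormalPeriod (of r)) 0 := rfl

/-! ## 3. Values of a presentation -/

/-- If `(x, 0) = Σ εᵢ κ̃(σᵢ)` in `V`, then `evalP x = Σ εᵢ ∫_{σᵢ}` as complex numbers. -/
theorem soloInformed_evalP_of_pieces {x : FormalPeriodRing} {k : ℕ} {σ : Fin k → PeriodSymbol}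
    {ε : Fin k → ℤ} (hN : ∀ i, SoloInformedIsNashPath (σ i).γ.toFun)
    (h : SoloInformedV.mk x 0 = ∑ i, ε i • soloInformedKappaTilde (σ i) (hN i)) :
    ((evalP x : ℝ) : ℂ) = ∑ i, (ε i : ℂ) * (σ i).period := by
  have hfst : evalP (SoloInformedV.mk x 0).fst =
      evalP (∑ i, ε i • soloInformedKappaTilde (σ i) (hN i)).fst := by rw [h]
  have hsnd : evalP (SoloInformedV.mk x 0).snd =
      evalP (∑ i, ε i • soloInformedKappaTilde (σ i) (hN i)).snd := by rw [h]
  rw [SoloInformedV.fst_mk, SoloInformedV.fst_sum, map_sum] at hfst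
  rw [SoloInformedV.snd_mk, map_zero, SoloInformedV.snd_sum, map_sum] at hsnd
  simp_rw [soloInformed_evalP_fst_zsmul_kappaTilde] at hfst
  simp_rw [soloInformed_evalP_snd_zsmul_kappaTilde] at hsnd
  apply Complex.ext
  · rw [Complex.ofReal_re, Complex.re_sum]
    refine hfst.trans (Finset.sum_congr rfl fun i _ => ?_)
    simp [Complex.mul_re]
  · rw [Complex.ofReal_im, Complex.im_sum]
    refine hsnd.trans (Finset.sum_congr rfl fun i _ => ?_)
    simp [Complex.mul_im]

/-! ## 4. THEOREM XV — the curve sector is decided -/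

/-- **THEOREM XV (kernel form).** Granted the Huber–Wüstholz theorem on linear relations of curve
periods, a class of the curve sector with value `0` is `0`: the evaluation map `evalP : P → ℝ` has
no kernel on the curve sector.  Proof: write `(x,0) = Σ εᵢ κ̃(σᵢ)`; then `Σ εᵢ ∫_{σᵢ} = evalP x = 0`
is a vanishing `ℤ`-linear combination of curve periods, hence (Huber–Wüstholz) an algebraic
combination of elementary relations, each killed by `κ` (`soloInformed_kappaKills`); so
`(x, 0) = κ(Σ εᵢ σᵢ) = 0`. [Huber–Wüstholz 2022, Thm. 13.3] -/
theorem soloInformed_eq_zero_of_mem_curveSector (hHW : HuberWustholzCurvePeriods)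
    {x : FormalPeriodRing} (hx : SoloInformedV.mk x 0 ∈ soloInformedKappaSpan) (h0 : evalP x = 0) :
    x = 0 := by
  obtain ⟨k, σ, ε, hN, hrep⟩ := soloInformed_mk_mem_span_iff.1 hx
  have hv := soloInformed_evalP_of_pieces hN hrep
  rw [h0] at hv
  obtain ⟨κ, hκ, hkill⟩ := soloInformed_kappaKills
  set c0 : PeriodSymbol →₀ SoloInformedCxAlg := soloInformedPiecesComb σ ε with hc0
  have halg : ∀ s, IsAlgebraic ℚ (soloInformedCoeFinsupp c0 s) := fun s => by
    rw [soloInformedCoeFinsupp_apply]; exact (c0 s).isAlgebraic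
  have heval : evalCombination (soloInformedCoeFinsupp c0) = 0 := by
    rw [hc0, soloInformed_evalCombination_piecesComb, ← hv]
    simp
  -- Huber–Wüstholz
  obtain ⟨m, ρ, a, hρ, ha, hsum⟩ := hHW _ halg heval
  -- the coefficients of the elementary relations (R1)–(R5) are algebraic
  have hcoef : ∀ {τ : PeriodSymbol →₀ ℂ}, IsElementaryRelation τ →
      ∀ s : PeriodSymbol, IsAlgebraic ℚ (τ s) := by
    intro τ hτ s
    cases hτ with
    | add Z hZ γ ω ω₁ ω₂ h h₁ h₂ hω =>
      simp only [Finsupp.coe_sub, Pi.sub_apply]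
      exact ((soloInformed_isAlgebraic_single isAlgebraic_one s).sub
        (soloInformed_isAlgebraic_single isAlgebraic_one s)).sub
        (soloInformed_isAlgebraic_single isAlgebraic_one s)
    | smul Z hZ γ a ha ω ω' h h' hω =>
      simp only [Finsupp.coe_sub, Finsupp.coe_smul, Pi.sub_apply, Pi.smul_apply, smul_eq_mul]
      exact (soloInformed_isAlgebraic_single isAlgebraic_one s).sub
        (ha.mul (soloInformed_isAlgebraic_single isAlgebraic_one s))
    | vanish Z hZ γ ω h hv => exact soloInformed_isAlgebraic_single isAlgebraic_one s
    | exact Z hZ γ P hP ω h hω =>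
      simp only [Finsupp.coe_sub, Finsupp.coe_smul, Pi.sub_apply, Pi.smul_apply, smul_eq_mul]
      refine (soloInformed_isAlgebraic_single isAlgebraic_one s).sub (IsAlgebraic.mul ?_
        (soloInformed_isAlgebraic_single isAlgebraic_one s))
      exact (hP.isAlgebraic_eval γ.algebraic_one).sub (hP.isAlgebraic_eval γ.algebraic_zero)
    | pushforward Z Z' hZ hZ' f hf hfZ ω' h' ω h hω γ γ' hγ' =>
      simp only [Finsupp.coe_sub, Pi.sub_apply]
      exact (soloInformed_isAlgebraic_single isAlgebraic_one s).sub
        (soloInformed_isAlgebraic_single isAlgebraic_one s)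
    | boundary Z hZ ω h τ hτ hτZ e₀₁ e₁₂ e₀₂ h₀₁ h₁₂ h₀₂ =>
      simp only [Finsupp.coe_sub, Finsupp.coe_add, Pi.sub_apply, Pi.add_apply]
      exact ((soloInformed_isAlgebraic_single isAlgebraic_one s).add
        (soloInformed_isAlgebraic_single isAlgebraic_one s)).sub
        (soloInformed_isAlgebraic_single isAlgebraic_one s)
  -- descend the coefficients to `ℚ̄`
  let ρ0 : Fin m → PeriodSymbol →₀ SoloInformedCxAlg := fun l =>
    soloInformedLiftFinsupp (ρ l) (hcoef (hρ l))
  let a0 : Fin m → SoloInformedCxAlg := fun l => ⟨a l, mem_algebraicClosure_iff.mpr (ha l)⟩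
  have hdesc : c0 = ∑ l, a0 l • ρ0 l := by
    apply soloInformedCoeFinsupp_injective
    rw [hsum, soloInformedCoeFinsupp_sum]
    refine Finset.sum_congr rfl fun l _ => ?_
    rw [soloInformedCoeFinsupp_smul, soloInformedCoeFinsupp_lift]
  -- apply `κ`
  have hK0 : Finsupp.linearCombination SoloInformedCxAlg κ c0 = 0 := by
    rw [hdesc, map_sum]
    refine Finset.sum_eq_zero fun l _ => ?_
    rw [map_smul, hkill (ρ0 l) (by rw [soloInformedCoeFinsupp_lift]; exact hρ l), smul_zero]
  rw [hc0, soloInformed_linearCombination_piecesComb σ ε κ hN hκ, ← hrep] at hK0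
  have hfst := congrArg SoloInformedV.fst hK0
  simpa [SoloInformedV.fst_mk] using hfst

/-- **THEOREM XV (injectivity form).** Granted Huber–Wüstholz, `evalP` is injective on the curve
sector: two classes presented by curve pieces with the same value are equal in
`P = FormalRep ⧸ relations`. -/
theorem soloInformed_evalP_injOn_curveSector (hHW : HuberWustholzCurvePeriods) :
    Set.InjOn evalP {x : FormalPeriodRing | SoloInformedV.mk x 0 ∈ soloInformedKappaSpan} := by
  intro x hx y hy hxy
  have h := soloInformed_eq_zero_of_mem_curveSector hHW (soloInformed_mk_sub_mem_span hx hy)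
    (by rw [map_sub, hxy, sub_self])
  exact sub_eq_zero.1 h

/-- **THEOREM XV (formal combinations).** A formal `ℤ`-combination of integral representations
whose class lies in the curve sector and whose value vanishes is a Kontsevich–Zagier relation. -/
theorem soloInformed_mem_relations_of_mem_curveSector (hHW : HuberWustholzCurvePeriods)
    {c : FormalRep} (hc : SoloInformedV.mk (toFormalPeriod c) 0 ∈ soloInformedKappaSpan)
    (h0 : eval c = 0) :
    c ∈ relations :=
  toFormalPeriod_eq_zero_iff.1
    (soloInformed_eq_zero_of_mem_curveSector hHW hc (by rw [evalP_toFormalPeriod, h0]))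

/-- **THEOREM XV (representations, any dimensions).** Granted Huber–Wüstholz, two integral
representations `r` (dimension `n`) and `r'` (dimension `m`) whose classes lie in the curve sector
and whose values agree are connected by the four Kontsevich–Zagier moves. -/
theorem soloInformed_equivalent_of_mem_curveSector (hHW : HuberWustholzCurvePeriods) {n m : ℕ}
    {r : IntegralRep n} {r' : IntegralRep m} (hr : soloInformedPer r ∈ soloInformedKappaSpan)
    (hr' : soloInformedPer r' ∈ soloInformedKappaSpan) (hv : r.value = r'.value) :
    Equivalent r r' := by
  rw [soloInformedPer_eq_mk] at hr hr'
  have h := soloInformed_evalP_injOn_curveSector hHW hr hr'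
    (by rw [evalP_toFormalPeriod_of, evalP_toFormalPeriod_of, hv])
  change of r - of r' ∈ relations
  exact toFormalPeriod_eq_iff.1 h

/-! ## 5. Members of the curve sector -/

/-- The sector is closed under the moves: if `[ρ] − Σᵢ [Rᵢ]` is a relation and every `Rᵢ` lies in
the sector, so does `ρ` (any dimensions; `soloInformedPer_sum`). -/
theorem soloInformed_per_mem_span_of_sub_sum_mem_relations {n m : ℕ} {ι : Type*}
    (s : Finset ι) {ρ : IntegralRep n} {R : ι → IntegralRep m}
    (h : of ρ - ∑ i ∈ s, of (R i) ∈ relations)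
    (hR : ∀ i ∈ s, soloInformedPer (R i) ∈ soloInformedKappaSpan) :
    soloInformedPer ρ ∈ soloInformedKappaSpan := by
  rw [soloInformedPer_sum s h]
  exact sum_mem fun i hi => hR i hi

/-- Equivalent representations lie in the sector together (same dimension). -/
theorem soloInformed_per_mem_span_congr {n : ℕ} {ρ ρ' : IntegralRep n}
    (h : of ρ - of ρ' ∈ relations) (hρ' : soloInformedPer ρ' ∈ soloInformedKappaSpan) :
    soloInformedPer ρ ∈ soloInformedKappaSpan := by
  rw [soloInformedPer_congr h]
  exact hρ'

/-- A relation lies in the sector (its class is `0`). -/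
theorem soloInformed_mk_mem_span_of_mem_relations {c : FormalRep} (h : c ∈ relations) :
    SoloInformedV.mk (toFormalPeriod c) 0 ∈ soloInformedKappaSpan := by
  rw [toFormalPeriod_eq_zero_of_mem h]
  have h0 : SoloInformedV.mk (0 : FormalPeriodRing) 0 = 0 := by
    ext <;> simp [SoloInformedV.fst_mk, SoloInformedV.snd_mk]
  rw [h0]
  exact zero_mem _

/-- **Compact planar volume representations are members** (the content of
`soloInformed_planarPieces`: cylindrical decomposition, Newton–Leibniz along `y`, and the arc
lemma `soloInformed_arc_mem_span`; the interior plays no role). -/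
theorem soloInformed_per_mem_span_planar (r : IntegralRep 2) (hK : IsCompact r.domain)
    (hr1 : ∀ x ∈ r.domain, r.integrand x = 1) :
    soloInformedPer r ∈ soloInformedKappaSpan := by
  obtain ⟨k, a, b, ρ, hab, ha, hb, hdom, hcont, hbdd, hrel⟩ := soloInformed_planarBands r hK hr1
  exact soloInformed_per_mem_span_of_sub_sum_mem_relations Finset.univ hrel fun i _ =>
    soloInformed_arc_mem_span (ρ i) (hab i) (ha i) (hb i) (hdom i) (hcont i) (hbdd i)

/-! ## 6. Volume rungs on a class -/

/-- **Rung `d` holds on every class inside the curve sector** (any `d`), granted Huber–Wüstholz: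
if the volume representations of a class `𝒞` of `d`-dimensional representations have `Per` in the
span of realised curve symbols, then equal volumes within `𝒞` imply KZ-equivalence.  (The
hypotheses "compact, non-empty interior, integrand `1`" of `SoloInformedVolumeRung` are not even
needed.) [Huber–Wüstholz 2022, Thm. 13.3] -/
theorem soloInformed_volumeRung_on_class_of_mem_span (hHW : HuberWustholzCurvePeriods) {d : ℕ}
    {𝒞 : Set (IntegralRep d)} (h𝒞 : ∀ r ∈ 𝒞, soloInformedPer r ∈ soloInformedKappaSpan)
    {r r' : IntegralRep d} (hr : r ∈ 𝒞) (hr' : r' ∈ 𝒞) (hv : r.value = r'.value) :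
    Equivalent r r' :=
  soloInformed_equivalent_of_mem_curveSector hHW (h𝒞 r hr) (h𝒞 r' hr') hv

end Summit.KontsevichZagierPeriods.KontsevichZagierPeriods.Theorems
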